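import Summits.QuantumFields.YangMills.Theorems.BalabanUVNodesN15KingModelPauliLinksGap
import HarnessLib

/-!
# BalabanUVNodes ∕ N15 — THE KING-MODEL RUNG (PART Ϸ-e): TIGHTNESS OF THE PAULI GAP — at a LATTICE link angle `a = q′_{ν₀}` the plane wave `χ_q ⊗ (1,−1)` is COVARIANTLY CONSTANT along
# `ν₀` and an EXACT eigenvector of `−cΔ_W + m²` with eigenvalue `m² + 2c(1 − cos b) = m² + c(sin²b + (1−cos b)²)`; with PART Ϸ-d: `c·min(sin²a,sin²b) ≤ λ_min − m² ≤ c·sin²b + c(1−cos b)²`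
# — asymptotically exact; for EVERY `a` the same mode gives `λ_min ≤ m² + 2c(1−cos b) + 2c(1 − cos(q′_{ν₀} − a))` (a toron-size correction)
# (Track A, DAG node N15 = NE2; FAN-OUT v1.1 §N15 s3 «KING-MODEL RUNG … + what the curved case adds»; count-neutral)

HONEST FRAMING.  Count-neutral (cell `pub-ymgap`, seat `pub-ymgap-dag-n15-e` g48; `--supports stmt-QuantumFields-27247 --as helper` = K3ᴬ, KEY MAP v3).  Exact finite identities for King's fine
covariance layer `−cΔ_U + m²` (Ͱ-a `covLapF`) at the constant Pauli pair (Ϸ-c `pauliLink`) on ONE finite torus; NOT Bałaban's `G_k(U)`; NOT a node discharge; nothing continuum ∕ ℝ⁴ ∕ OS ∕ Clay.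

THE MECHANISM.  `ξ = (1,−1)` is the `−1` eigenvector of `σ₁`, so `e^{iaσ₁}ξ = e^{−ia}ξ`: along `ν₀` the plane wave `e^{iq′x}ξ` with `q′ = a` satisfies `v_x − W_{ν₀}v_{x+e_{ν₀}} = 0` — a PARALLEL
SECTION of the dressed direction (cf. Ͱ-d `covLapF_massless_mulVec_eq_zero_iff`); it pays only the `ν₁` bond `‖ξ − e^{ibσ₂}ξ‖² = 2(1−cos b)‖ξ‖²` (the `σ₂`-expectation of `ξ` vanishes) and
nothing on the flat directions.  Symmetrically `(1,−i)` (the `−1` eigenvector of `σ₂`) at `q′_{ν₁} = b` gives `m² + 2c(1 − cos a)`.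

THE RESULTS (`K` any period vector; `ν₀ ≠ ν₁`; `q` a momentum SUPPORTED ON `ν₀` (`q_μ = 0`, `μ ≠ ν₀`), `q′ = sOf K q ν₀ = 2π·valMinAbs(q_{ν₀})∕K_{ν₀}`):
* §1 letters: `xiX = (1,−1)`, `xiY = (1,−i)`, `rotX_mulVec_xiX` (`e^{iaσ₁}ξ = e^{−ia}ξ`), `conjTranspose_rotX_mulVec_xiX`, `rotY_mulVec_xiY`, `conjTranspose_rotY_mulVec_xiY`, `rotY_add_conjTranspose`
  (`= 2cos b·1`), `rotX_add_conjTranspose`, `chi_unitVec_of_apply_eq_zero` (`ψ_μ(q) = 1` off the support), `exp_sOf_mul_conj` letters;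
* §2 ★★★ **`fibreOp_pauliLink_mulVec_xiX`** (`a = q′`: `H_W(q)ξ = (m² + 2c(1 − cos b))ξ`), ★★★ **`exists_eigenvalue_covLapF_pauliLink_eq`** (`m² + 2c(1−cos b)` IS an eigenvalue on the torus,
  Ϸ-b `exists_eigenvalue_eq_of_fibre`); the mirror statements `fibreOp_pauliLink_mulVec_xiY`, `exists_eigenvalue_covLapF_pauliLink_eq'` (`b = q′_{ν₁}` ⟹ eigenvalue `m² + 2c(1 − cos a)`);
* §3 ★★★ **`pauli_two_sided`** (`∀ i, m² + c·min(sin²a,sin²b) ≤ λ_i` ∧ `∃ i, λ_i = m² + c(sin²b + (1−cos b)²)`), `one_sub_cos_sq_le` (`(1 − cos b)² ≤ b⁴∕4`: the window `[c sin²b, c sin²b + c(1−cos b)²]`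
  has QUARTIC width at QUADRATIC position — asymptotically exact for the weaker link);
* §4 ★★ **`exists_eigenvalue_covLapF_pauliLink_le`** — for EVERY link angle `a` and every momentum `q` supported on `ν₀` (any `c`): `∃ i, λ_i ≤ m² + 2c(1 − cos b) + 2c(1 − cos(q′ − a))` (Rayleigh on
  `χ_q ⊗ (1,−1)`, Ϸ-b `exists_eigenvalue_le_fibre`; the last term is the holonomy mismatch of the nearest lattice momentum, `≤ c(q′−a)²`, of toron size `O(c∕K²)` for the best `q`).
PRIOR TREE ART (by name): Ϸ-b (`fibreOp`, `exists_eigenvalue_eq_of_fibre`, `exists_eigenvalue_le_fibre`, `re_form_fibreOp_eq`), Ϸ-c (`rotX`, `rotY`, `pauliX∕Y`, `pauliLink`, `pauliLink_fst∕snd∕of_ne`,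
`pauliLink_mem_unitaryGroup`, `conjTranspose_rotX∕Y`, `norm_sq_sub_smul_rotX∕Y`, `re_inner_pauliX∕Y`), Ϸ-d (`eigenvalues_covLapF_pauliLink_ge`), `B5Prop11Plancherel` (`chi_unitVec`, `sOf`),
`King1986.Torus.chi_unitVec_eq_exp`, Mathlib (`Complex.exp_mul_I`, `Complex.exp_conj`, `Finset.sum_eq_add`, `Real.one_sub_sq_div_two_le_cos`).  Dedup (rg at filing): basename 0 files; needles
`xiX|xiY|fibreOp_pauliLink_mulVec|exists_eigenvalue_covLapF_pauliLink|pauli_two_sided` 0 tree files.  Locators: [King1986] (4.4) p.670, (4.35) p.674, (2.12) p.653; [Balaban1984PropagatorsI] (1.29) p.23;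
[Balaban1985BackgroundPropagators] (3.23) p.394; [HornJohnson2013] Thm 4.2.2.  0 `sorry`, 2 `def`.
-/

noncomputable section

open scoped BigOperators ComplexConjugate ComplexOrder InnerProductSpace
open Finset Matrix WithLp

namespace Summit.QuantumFields.YangMills.BalabanUVNodes.N15KingModelRung.ConstantCurvature

open Literature.MathematicalPhysics.QuantumFieldTheory.Balaban1983to89.B5Prop11Plancherel (Tor unitVec chi chi_unitVec sOf)
open Literature.MathematicalPhysics.QuantumFieldTheory.King1986.Torus (chi_unitVec_eq_exp)
open Summit.QuantumFields.YangMills.BalabanUVNodes.N15KingModelRung.Covariant (covLapF fib isHermitian_covLapF)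
open Summit.QuantumFields.YangMills.BalabanUVNodes.N15KingModelRung.TorusSpectral (norm_chi_eq_one)

/-! ## §1 Letters: the polarisations `(1,−1)`, `(1,−i)` and the phases of a momentum supported on one direction -/

section Letters

/-- `ξ_X = (1, −1)`, the `−1` eigenvector of `σ₁`. [folklore] -/
def xiX : Fin 2 → ℂ := ![1, -1]
/-- `ξ_Y = (1, −i)`, the `−1` eigenvector of `σ₂`. [folklore] -/
def xiY : Fin 2 → ℂ := ![1, -Complex.I]

/-- `ξ_X ≠ 0`. [folklore] -/
theorem xiX_ne_zero : xiX ≠ 0 := fun h => by simpa [xiX] using congr_fun h 0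
/-- `ξ_Y ≠ 0`. [folklore] -/
theorem xiY_ne_zero : xiY ≠ 0 := fun h => by simpa [xiY] using congr_fun h 0
/-- `Σ|ξ_X,i|² = 2`. [folklore] -/
theorem sum_norm_sq_xiX : ∑ i, ‖xiX i‖ ^ 2 = 2 := by simp [xiX, Fin.sum_univ_two]; norm_num
/-- `Σ|ξ_Y,i|² = 2`. [folklore] -/
theorem sum_norm_sq_xiY : ∑ i, ‖xiY i‖ ^ 2 = 2 := by simp [xiY, Fin.sum_univ_two]; norm_num

/-- `e^{−ia} = cos a − i sin a`. [folklore] -/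
theorem exp_neg_mul_I_eq (a : ℝ) : Complex.exp (-(a : ℂ) * Complex.I) = (Real.cos a : ℂ) - (Real.sin a : ℂ) * Complex.I := by
  rw [Complex.exp_mul_I, Complex.cos_neg, Complex.sin_neg, ← Complex.ofReal_cos, ← Complex.ofReal_sin]; ring
/-- `e^{ia} = cos a + i sin a`. [folklore] -/
theorem exp_mul_I_eq (a : ℝ) : Complex.exp ((a : ℂ) * Complex.I) = (Real.cos a : ℂ) + (Real.sin a : ℂ) * Complex.I := by
  rw [Complex.exp_mul_I, ← Complex.ofReal_cos, ← Complex.ofReal_sin]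
/-- `e^{ia}·e^{−ia} = 1`. [folklore] -/
theorem exp_mul_I_mul_exp_neg (a : ℝ) : Complex.exp ((a : ℂ) * Complex.I) * Complex.exp (-(a : ℂ) * Complex.I) = 1 := by
  rw [← Complex.exp_add, neg_mul, add_neg_cancel, Complex.exp_zero]
/-- `conj e^{ia} = e^{−ia}`. [folklore] -/
theorem conj_exp_mul_I (a : ℝ) : conj (Complex.exp ((a : ℂ) * Complex.I)) = Complex.exp (-(a : ℂ) * Complex.I) := by
  rw [← Complex.exp_conj, map_mul, Complex.conj_ofReal, Complex.conj_I]; ring_nf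

/-- ★ `e^{iaσ₁}ξ_X = e^{−ia}ξ_X` — the polarisation `(1,−1)` turns the dressed hop into a pure phase. [folklore] -/
theorem rotX_mulVec_xiX (a : ℝ) : rotX a *ᵥ xiX = Complex.exp (-(a : ℂ) * Complex.I) • xiX := by
  rw [exp_neg_mul_I_eq]
  funext i; fin_cases i <;> simp [rotX, xiX, Matrix.mulVec, dotProduct, Fin.sum_univ_two] <;> ring
/-- `(e^{iaσ₁})^*ξ_X = e^{ia}ξ_X`. [folklore] -/
theorem conjTranspose_rotX_mulVec_xiX (a : ℝ) : (rotX a)ᴴ *ᵥ xiX = Complex.exp ((a : ℂ) * Complex.I) • xiX := by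
  rw [conjTranspose_rotX, exp_mul_I_eq]
  funext i; fin_cases i <;> simp [xiX, Matrix.mulVec, dotProduct, Fin.sum_univ_two]
/-- ★ `e^{ibσ₂}ξ_Y = e^{−ib}ξ_Y`. [folklore] -/
theorem rotY_mulVec_xiY (b : ℝ) : rotY b *ᵥ xiY = Complex.exp (-(b : ℂ) * Complex.I) • xiY := by
  rw [exp_neg_mul_I_eq]
  funext i; fin_cases i
  · simp [rotY, xiY, Matrix.mulVec, dotProduct, Fin.sum_univ_two]; ring
  · simp [rotY, xiY, Matrix.mulVec, dotProduct, Fin.sum_univ_two]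
    linear_combination (-(Complex.sin (b : ℂ))) * Complex.I_sq
/-- `(e^{ibσ₂})^*ξ_Y = e^{ib}ξ_Y`. [folklore] -/
theorem conjTranspose_rotY_mulVec_xiY (b : ℝ) : (rotY b)ᴴ *ᵥ xiY = Complex.exp ((b : ℂ) * Complex.I) • xiY := by
  rw [conjTranspose_rotY, exp_mul_I_eq]
  funext i; fin_cases i
  · simp [xiY, Matrix.mulVec, dotProduct, Fin.sum_univ_two]
  · simp [xiY, Matrix.mulVec, dotProduct, Fin.sum_univ_two]
    linear_combination (Complex.sin (b : ℂ)) * Complex.I_sq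
/-- `e^{ibσ₂} + e^{−ibσ₂} = 2cos b·1`. [folklore] -/
theorem rotY_add_conjTranspose (b : ℝ) : rotY b + (rotY b)ᴴ = (2 * (Real.cos b : ℂ)) • (1 : Matrix (Fin 2) (Fin 2) ℂ) := by
  rw [conjTranspose_rotY]
  ext i j; fin_cases i <;> fin_cases j <;> simp [rotY, -Complex.ofReal_cos, -Complex.ofReal_sin] <;> ring
/-- `e^{iaσ₁} + e^{−iaσ₁} = 2cos a·1`. [folklore] -/
theorem rotX_add_conjTranspose (a : ℝ) : rotX a + (rotX a)ᴴ = (2 * (Real.cos a : ℂ)) • (1 : Matrix (Fin 2) (Fin 2) ℂ) := by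
  rw [conjTranspose_rotX]
  ext i j; fin_cases i <;> fin_cases j <;> simp [rotX, -Complex.ofReal_cos, -Complex.ofReal_sin] <;> ring

variable {d : ℕ} (K : Fin (d + 1) → ℕ) [hK : ∀ μ, NeZero (K μ)]

/-- Off the support of the momentum the phases are trivial: `q_μ = 0 ⟹ ψ_μ(q) = 1`. [cite: King1986, (4.35) p.674] -/
theorem chi_unitVec_of_apply_eq_zero {q : Tor K} {μ : Fin (d + 1)} (hq : q μ = 0) : chi K q (unitVec K μ) = 1 := by
  rw [chi_unitVec, hq, AddChar.map_zero_eq_one]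

end Letters

/-! ## §2 The exact eigenvector at a lattice link angle -/

section Exact

variable {d : ℕ} (K : Fin (d + 1) → ℕ) [hK : ∀ μ, NeZero (K μ)]

/-- ★★ **THE DRESSING SUM ON `ξ_X`** at a momentum `q` supported on `ν₀` with `a = q′_{ν₀}`:
`Σ_μ(ψ_μ·W_μξ + ψ̄_μ·W_μ^*ξ) = (2(d+1) + (2cos b − 2))·ξ` — the `ν₀`-term is the FLAT value `2ξ` (`e^{ia}e^{−ia} = 1`), the `ν₁`-term is `2cos b·ξ`, the other `d − 1` terms are `2ξ`.
[cite: King1986, (4.4) p.670, (4.35) p.674] -/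
theorem sum_dressing_mulVec_xiX (b : ℝ) {ν₀ ν₁ : Fin (d + 1)} (hν : ν₀ ≠ ν₁) (q : Tor K) (hq : ∀ μ, μ ≠ ν₀ → q μ = 0) :
    ∑ μ, (chi K q (unitVec K μ) • (pauliLink (d := d) (sOf K q ν₀) b ν₀ ν₁ μ *ᵥ xiX)
        + conj (chi K q (unitVec K μ)) • ((pauliLink (d := d) (sOf K q ν₀) b ν₀ ν₁ μ)ᴴ *ᵥ xiX))
      = ((2 * ((d : ℝ) + 1) + (2 * Real.cos b - 2) : ℝ) : ℂ) • xiX := by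
  set a := sOf K q ν₀ with ha
  set g : Fin (d + 1) → (Fin 2 → ℂ) := fun μ => chi K q (unitVec K μ) • (pauliLink (d := d) a b ν₀ ν₁ μ *ᵥ xiX)
    + conj (chi K q (unitVec K μ)) • ((pauliLink (d := d) a b ν₀ ν₁ μ)ᴴ *ᵥ xiX) with hg
  -- the three kinds of directions
  have h0 : g ν₀ = (2 : ℂ) • xiX := by
    have hψ : chi K q (unitVec K ν₀) = Complex.exp ((a : ℂ) * Complex.I) := by rw [ha]; exact chi_unitVec_eq_exp K q ν₀
    simp only [hg, pauliLink_fst, rotX_mulVec_xiX, conjTranspose_rotX_mulVec_xiX, smul_smul, hψ, conj_exp_mul_I, exp_mul_I_mul_exp_neg]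
    rw [mul_comm, exp_mul_I_mul_exp_neg, ← add_smul]; norm_num
  have h1 : g ν₁ = (2 * (Real.cos b : ℂ)) • xiX := by
    simp only [hg, pauliLink_snd a b hν, chi_unitVec_of_apply_eq_zero K (hq ν₁ hν.symm), map_one, one_smul]
    rw [← Matrix.add_mulVec, rotY_add_conjTranspose, Matrix.smul_mulVec, Matrix.one_mulVec]
  have hflat : ∀ μ, μ ≠ ν₀ → μ ≠ ν₁ → g μ = (2 : ℂ) • xiX := fun μ hμ0 hμ1 => by
    simp only [hg, pauliLink_of_ne a b hμ0 hμ1, chi_unitVec_of_apply_eq_zero K (hq μ hμ0), map_one, one_smul, conjTranspose_one, Matrix.one_mulVec]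
    rw [two_smul]
  -- every direction carries `2ξ`, plus the correction `(2cos b − 2)ξ` at `ν₁`
  have hsplit : ∀ μ, g μ = (2 : ℂ) • xiX + (if μ = ν₁ then (2 * (Real.cos b : ℂ) - 2) • xiX else 0) := fun μ => by
    by_cases hμ1 : μ = ν₁
    · subst hμ1; rw [if_pos rfl, h1, ← add_smul]; congr 1; ring
    · rw [if_neg hμ1, add_zero]
      by_cases hμ0 : μ = ν₀
      · subst hμ0; exact h0
      · exact hflat μ hμ0 hμ1
  show ∑ μ, g μ = _
  rw [Finset.sum_congr rfl fun μ _ => hsplit μ, Finset.sum_add_distrib, Finset.sum_const, Finset.card_univ, Fintype.card_fin, Finset.sum_ite_eq' Finset.univ ν₁,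
    if_pos (Finset.mem_univ _), ← Nat.cast_smul_eq_nsmul ℂ, smul_smul, ← add_smul]
  congr 1
  push_cast
  ring

/-- ★★★ **THE EXACT EIGENVECTOR IN THE FIBRE**: at a momentum `q` supported on `ν₀` and the LATTICE link angle `a = q′_{ν₀}`:
`H_W(q)ξ_X = (m² + 2c(1 − cos b))·ξ_X` — the mode is covariantly constant along `ν₀` and pays only the `ν₁` bond. [cite: King1986, (4.4) p.670, (4.35) p.674; Balaban1985BackgroundPropagators, (3.23) p.394] -/
theorem fibreOp_pauliLink_mulVec_xiX (c m2 b : ℝ) {ν₀ ν₁ : Fin (d + 1)} (hν : ν₀ ≠ ν₁) (q : Tor K) (hq : ∀ μ, μ ≠ ν₀ → q μ = 0) :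
    fibreOp K (pauliLink (d := d) (sOf K q ν₀) b ν₀ ν₁) c m2 q *ᵥ xiX = ((m2 + 2 * c * (1 - Real.cos b) : ℝ) : ℂ) • xiX := by
  rw [fibreOp, Matrix.sub_mulVec, Matrix.smul_mulVec, Matrix.one_mulVec, Matrix.smul_mulVec, Matrix.sum_mulVec]
  simp only [Matrix.add_mulVec, Matrix.smul_mulVec]
  rw [sum_dressing_mulVec_xiX K b hν q hq, smul_smul, ← sub_smul]
  congr 1
  push_cast
  ring

/-- ★★★ **`m² + 2c(1 − cos b)` IS AN EIGENVALUE OF `−cΔ_W + m²` ON THE TORUS** whenever the `σ₁`-link angle is a lattice angle `a = 2π·k∕K_{ν₀}` (any `b`, `c`, `m²`, `K`; eigenvector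
`χ_q ⊗ (1,−1)`). [cite: King1986, (4.4) p.670, (4.35) p.674; HornJohnson2013, Thm 4.2.2] -/
theorem exists_eigenvalue_covLapF_pauliLink_eq (c m2 b : ℝ) {ν₀ ν₁ : Fin (d + 1)} (hν : ν₀ ≠ ν₁) (q : Tor K) (hq : ∀ μ, μ ≠ ν₀ → q μ = 0) :
    ∃ i, (isHermitian_covLapF K c m2 (kingConstLink K (pauliLink (d := d) (sOf K q ν₀) b ν₀ ν₁))).eigenvalues i = m2 + 2 * c * (1 - Real.cos b) :=
  exists_eigenvalue_eq_of_fibre K xiX_ne_zero (fibreOp_pauliLink_mulVec_xiX K c m2 b hν q hq)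

/-- ★★ THE MIRROR DRESSING SUM ON `ξ_Y` (momentum supported on `ν₁`, `b = q′_{ν₁}`): `Σ_μ(…) = (2(d+1) + (2cos a − 2))·ξ_Y`. [cite: King1986, (4.4) p.670, (4.35) p.674] -/
theorem sum_dressing_mulVec_xiY (a : ℝ) {ν₀ ν₁ : Fin (d + 1)} (hν : ν₀ ≠ ν₁) (q : Tor K) (hq : ∀ μ, μ ≠ ν₁ → q μ = 0) :
    ∑ μ, (chi K q (unitVec K μ) • (pauliLink (d := d) a (sOf K q ν₁) ν₀ ν₁ μ *ᵥ xiY)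
        + conj (chi K q (unitVec K μ)) • ((pauliLink (d := d) a (sOf K q ν₁) ν₀ ν₁ μ)ᴴ *ᵥ xiY))
      = ((2 * ((d : ℝ) + 1) + (2 * Real.cos a - 2) : ℝ) : ℂ) • xiY := by
  set b := sOf K q ν₁ with hb
  set g : Fin (d + 1) → (Fin 2 → ℂ) := fun μ => chi K q (unitVec K μ) • (pauliLink (d := d) a b ν₀ ν₁ μ *ᵥ xiY)
    + conj (chi K q (unitVec K μ)) • ((pauliLink (d := d) a b ν₀ ν₁ μ)ᴴ *ᵥ xiY) with hg
  have h1 : g ν₁ = (2 : ℂ) • xiY := by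
    have hψ : chi K q (unitVec K ν₁) = Complex.exp ((b : ℂ) * Complex.I) := by rw [hb]; exact chi_unitVec_eq_exp K q ν₁
    simp only [hg, pauliLink_snd a b hν, rotY_mulVec_xiY, conjTranspose_rotY_mulVec_xiY, smul_smul, hψ, conj_exp_mul_I, exp_mul_I_mul_exp_neg]
    rw [mul_comm, exp_mul_I_mul_exp_neg, ← add_smul]; norm_num
  have h0 : g ν₀ = (2 * (Real.cos a : ℂ)) • xiY := by
    simp only [hg, pauliLink_fst, chi_unitVec_of_apply_eq_zero K (hq ν₀ hν), map_one, one_smul]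
    rw [← Matrix.add_mulVec, rotX_add_conjTranspose, Matrix.smul_mulVec, Matrix.one_mulVec]
  have hflat : ∀ μ, μ ≠ ν₀ → μ ≠ ν₁ → g μ = (2 : ℂ) • xiY := fun μ hμ0 hμ1 => by
    simp only [hg, pauliLink_of_ne a b hμ0 hμ1, chi_unitVec_of_apply_eq_zero K (hq μ hμ1), map_one, one_smul, conjTranspose_one, Matrix.one_mulVec]
    rw [two_smul]
  have hsplit : ∀ μ, g μ = (2 : ℂ) • xiY + (if μ = ν₀ then (2 * (Real.cos a : ℂ) - 2) • xiY else 0) := fun μ => by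
    by_cases hμ0 : μ = ν₀
    · subst hμ0; rw [if_pos rfl, h0, ← add_smul]; congr 1; ring
    · rw [if_neg hμ0, add_zero]
      by_cases hμ1 : μ = ν₁
      · subst hμ1; exact h1
      · exact hflat μ hμ0 hμ1
  show ∑ μ, g μ = _
  rw [Finset.sum_congr rfl fun μ _ => hsplit μ, Finset.sum_add_distrib, Finset.sum_const, Finset.card_univ, Fintype.card_fin, Finset.sum_ite_eq' Finset.univ ν₀,
    if_pos (Finset.mem_univ _), ← Nat.cast_smul_eq_nsmul ℂ, smul_smul, ← add_smul]
  congr 1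
  push_cast
  ring

/-- ★★ THE MIRROR EIGENVECTOR: `b = q′_{ν₁}` a lattice angle ⟹ `H_W(q)ξ_Y = (m² + 2c(1 − cos a))·ξ_Y`. [cite: King1986, (4.4) p.670, (4.35) p.674] -/
theorem fibreOp_pauliLink_mulVec_xiY (c m2 a : ℝ) {ν₀ ν₁ : Fin (d + 1)} (hν : ν₀ ≠ ν₁) (q : Tor K) (hq : ∀ μ, μ ≠ ν₁ → q μ = 0) :
    fibreOp K (pauliLink (d := d) a (sOf K q ν₁) ν₀ ν₁) c m2 q *ᵥ xiY = ((m2 + 2 * c * (1 - Real.cos a) : ℝ) : ℂ) • xiY := by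
  rw [fibreOp, Matrix.sub_mulVec, Matrix.smul_mulVec, Matrix.one_mulVec, Matrix.smul_mulVec, Matrix.sum_mulVec]
  simp only [Matrix.add_mulVec, Matrix.smul_mulVec]
  rw [sum_dressing_mulVec_xiY K a hν q hq, smul_smul, ← sub_smul]
  congr 1
  push_cast
  ring

/-- ★★ … hence `m² + 2c(1 − cos a)` IS an eigenvalue when the `σ₂`-link angle `b` is a lattice angle of direction `ν₁`. [cite: King1986, (4.4) p.670, (4.35) p.674; HornJohnson2013, Thm 4.2.2] -/
theorem exists_eigenvalue_covLapF_pauliLink_eq' (c m2 a : ℝ) {ν₀ ν₁ : Fin (d + 1)} (hν : ν₀ ≠ ν₁) (q : Tor K) (hq : ∀ μ, μ ≠ ν₁ → q μ = 0) :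
    ∃ i, (isHermitian_covLapF K c m2 (kingConstLink K (pauliLink (d := d) a (sOf K q ν₁) ν₀ ν₁))).eigenvalues i = m2 + 2 * c * (1 - Real.cos a) :=
  exists_eigenvalue_eq_of_fibre K xiY_ne_zero (fibreOp_pauliLink_mulVec_xiY K c m2 a hν q hq)

end Exact

/-! ## §3 The two-sided window -/

section TwoSided

variable {d : ℕ} (K : Fin (d + 1) → ℕ) [hK : ∀ μ, NeZero (K μ)]

omit hK in
/-- `2(1 − cos b) = sin²b + (1 − cos b)²`. [folklore] -/
theorem two_mul_one_sub_cos (b : ℝ) : 2 * (1 - Real.cos b) = Real.sin b ^ 2 + (1 - Real.cos b) ^ 2 := by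
  nlinarith [Real.sin_sq_add_cos_sq b]

/-- ★★★ **THE TWO-SIDED WINDOW FOR THE PAULI PAIR** (lattice `σ₁`-angle `a = q′_{ν₀}`, any `b`, `c ≥ 0`): every eigenvalue of `−cΔ_W + m²` is `≥ m² + c·min(sin²a, sin²b)` (PART Ϸ-d), and
`m² + c·(sin²b + (1 − cos b)²)` IS an eigenvalue — when `b` is the weaker link (`sin²b ≤ sin²a`) the bottom of the spectrum is pinned in `[m² + c·sin²b, m² + c·sin²b + c(1−cos b)²]`.
[cite: King1986, (4.4) p.670, (4.35) p.674; Balaban1985BackgroundPropagators, (3.23) p.394; HornJohnson2013, Thm 4.2.2] -/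
theorem pauli_two_sided {c : ℝ} (hc : 0 ≤ c) (m2 b : ℝ) {ν₀ ν₁ : Fin (d + 1)} (hν : ν₀ ≠ ν₁) (q : Tor K) (hq : ∀ μ, μ ≠ ν₀ → q μ = 0) :
    (∀ i, m2 + c * min (Real.sin (sOf K q ν₀) ^ 2) (Real.sin b ^ 2) ≤ (isHermitian_covLapF K c m2 (kingConstLink K (pauliLink (d := d) (sOf K q ν₀) b ν₀ ν₁))).eigenvalues i)
    ∧ ∃ i, (isHermitian_covLapF K c m2 (kingConstLink K (pauliLink (d := d) (sOf K q ν₀) b ν₀ ν₁))).eigenvalues i = m2 + c * (Real.sin b ^ 2 + (1 - Real.cos b) ^ 2) := by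
  refine ⟨fun i => eigenvalues_covLapF_pauliLink_ge K hc m2 _ b hν i, ?_⟩
  obtain ⟨i, hi⟩ := exists_eigenvalue_covLapF_pauliLink_eq K c m2 b hν q hq
  exact ⟨i, by rw [hi, ← two_mul_one_sub_cos]; ring⟩

omit hK in
/-- THE WINDOW IS QUARTICALLY THIN: `(1 − cos b)² ≤ b⁴∕4` (`0 ≤ 1 − cos b ≤ b²∕2`). [folklore] -/
theorem one_sub_cos_sq_le (b : ℝ) : (1 - Real.cos b) ^ 2 ≤ b ^ 4 / 4 := by
  have h1 : 1 - Real.cos b ≤ b ^ 2 / 2 := by have := Real.one_sub_sq_div_two_le_cos (x := b); linarith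
  have h0 : 0 ≤ 1 - Real.cos b := by have := Real.cos_le_one b; linarith
  nlinarith [mul_le_mul h1 h1 h0 (by positivity)]

/-- ★★ THE WEAKER LINK PINS THE BOTTOM: if `sin²b ≤ sin²a` (`a = q′_{ν₀}` a lattice angle) then `λ_min ∈ [m² + c·sin²b, m² + c·sin²b + c·b⁴∕4]`.
[cite: King1986, (4.4) p.670; HornJohnson2013, Thm 4.2.2] -/
theorem pauli_two_sided_weak {c : ℝ} (hc : 0 ≤ c) (m2 b : ℝ) {ν₀ ν₁ : Fin (d + 1)} (hν : ν₀ ≠ ν₁) (q : Tor K) (hq : ∀ μ, μ ≠ ν₀ → q μ = 0)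
    (hweak : Real.sin b ^ 2 ≤ Real.sin (sOf K q ν₀) ^ 2) :
    (∀ i, m2 + c * Real.sin b ^ 2 ≤ (isHermitian_covLapF K c m2 (kingConstLink K (pauliLink (d := d) (sOf K q ν₀) b ν₀ ν₁))).eigenvalues i)
    ∧ ∃ i, (isHermitian_covLapF K c m2 (kingConstLink K (pauliLink (d := d) (sOf K q ν₀) b ν₀ ν₁))).eigenvalues i ≤ m2 + c * Real.sin b ^ 2 + c * (b ^ 4 / 4) := by
  obtain ⟨hlow, i, hi⟩ := pauli_two_sided K hc m2 b hν q hq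
  refine ⟨fun j => le_trans (by rw [min_eq_right hweak]) (hlow j), i, ?_⟩
  rw [hi]
  nlinarith [mul_le_mul_of_nonneg_left (one_sub_cos_sq_le b) hc]

end TwoSided

/-! ## §4 Every link angle: the Rayleigh bound with the holonomy mismatch -/

section Rayleigh

variable {d : ℕ} (K : Fin (d + 1) → ℕ) [hK : ∀ μ, NeZero (K μ)]

omit hK in
/-- The `σ₁`-expectation of `(1,−1)` is `−‖ξ‖² = −2`. [folklore] -/
theorem re_inner_pauliX_xiX : RCLike.re ⟪(toLp 2 xiX : EuclideanSpace ℂ (Fin 2)), Matrix.toEuclideanLin pauliX (toLp 2 xiX)⟫_ℂ = -2 := by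
  rw [re_inner_pauliX]
  simp [xiX]
omit hK in
/-- The `σ₂`-expectation of `(1,−1)` vanishes. [folklore] -/
theorem re_inner_pauliY_xiX : RCLike.re ⟪(toLp 2 xiX : EuclideanSpace ℂ (Fin 2)), Matrix.toEuclideanLin pauliY (toLp 2 xiX)⟫_ℂ = 0 := by
  rw [re_inner_pauliY]
  simp [xiX]
omit hK in
/-- `‖(1,−1)‖² = 2`. [folklore] -/
theorem norm_toLp_xiX_sq : ‖(toLp 2 xiX : EuclideanSpace ℂ (Fin 2))‖ ^ 2 = 2 := by
  rw [EuclideanSpace.norm_sq_eq]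
  exact sum_norm_sq_xiX

/-- ★★ **THE BOND COSTS OF `χ_q ⊗ (1,−1)` FOR EVERY LINK ANGLE**: at a momentum supported on `ν₀` (phase `e^{iq′}` on `ν₀`, `1` elsewhere),
`Σ_μ‖ξ − ψ_μW_μξ‖² = 4(1 − cos(q′ − a)) + 4(1 − cos b)` (`ν₀`: `2(1 − cos q′cos a)·2 + 2 sin q′ sin a·(−2)`; `ν₁`: `2(1 − cos b)·2`; flat: `0`).
[cite: King1986, (4.4) p.670, (4.35) p.674; Balaban1985BackgroundPropagators, (3.3) p.391] -/
theorem sum_bond_sq_xiX (a b : ℝ) {ν₀ ν₁ : Fin (d + 1)} (hν : ν₀ ≠ ν₁) (q : Tor K) (hq : ∀ μ, μ ≠ ν₀ → q μ = 0) :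
    ∑ μ, ‖(toLp 2 xiX : EuclideanSpace ℂ (Fin 2)) - chi K q (unitVec K μ) • Matrix.toEuclideanLin (pauliLink (d := d) a b ν₀ ν₁ μ) (toLp 2 xiX)‖ ^ 2
      = 4 * (1 - Real.cos (sOf K q ν₀ - a)) + 4 * (1 - Real.cos b) := by
  set f : Fin (d + 1) → ℝ := fun μ => ‖(toLp 2 xiX : EuclideanSpace ℂ (Fin 2)) - chi K q (unitVec K μ) • Matrix.toEuclideanLin (pauliLink (d := d) a b ν₀ ν₁ μ) (toLp 2 xiX)‖ ^ 2
    with hf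
  have hψ : chi K q (unitVec K ν₀) = Complex.exp ((sOf K q ν₀ : ℂ) * Complex.I) := chi_unitVec_eq_exp K q ν₀
  have h0 : f ν₀ = 4 * (1 - Real.cos (sOf K q ν₀ - a)) := by
    simp only [hf, pauliLink_fst]
    rw [norm_sq_sub_smul_rotX a (norm_chi_eq_one K q (unitVec K ν₀)), re_inner_pauliX_xiX, norm_toLp_xiX_sq, hψ, Complex.exp_ofReal_mul_I_re, Complex.exp_ofReal_mul_I_im,
      Real.cos_sub]
    ring
  have h1 : f ν₁ = 4 * (1 - Real.cos b) := by
    simp only [hf, pauliLink_snd a b hν, chi_unitVec_of_apply_eq_zero K (hq ν₁ hν.symm)]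
    rw [norm_sq_sub_smul_rotY b (by simp : ‖(1 : ℂ)‖ = 1), re_inner_pauliY_xiX, norm_toLp_xiX_sq, Complex.one_re, Complex.one_im]
    ring
  have hflat : ∀ μ, μ ≠ ν₀ ∧ μ ≠ ν₁ → f μ = 0 := fun μ hμ => by
    simp only [hf, pauliLink_of_ne a b hμ.1 hμ.2, chi_unitVec_of_apply_eq_zero K (hq μ hμ.1), one_smul, Matrix.toLpLin_one, LinearMap.id_apply, sub_self, norm_zero]
    norm_num
  show ∑ μ, f μ = _
  rw [Finset.sum_eq_add ν₀ ν₁ hν (fun μ _ hμ => hflat μ hμ) (fun h => absurd (Finset.mem_univ _) h) (fun h => absurd (Finset.mem_univ _) h), h0, h1]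

/-- ★★ **FOR EVERY LINK ANGLE `a`**: at every momentum `q` supported on `ν₀`, SOME eigenvalue of `−cΔ_W + m²` is `≤ m² + 2c(1 − cos b) + 2c(1 − cos(q′_{ν₀} − a))` (`c ≥ 0`) — PART Ϸ-e's
exact value plus the holonomy mismatch of the lattice momentum, `2(1 − cos(q′−a)) ≤ (q′−a)²`, of toron size for the nearest `q′`. [cite: HornJohnson2013, Thm 4.2.2; King1986, (4.4) p.670, (4.35) p.674] -/
theorem exists_eigenvalue_covLapF_pauliLink_le (c m2 a b : ℝ) {ν₀ ν₁ : Fin (d + 1)} (hν : ν₀ ≠ ν₁) (q : Tor K) (hq : ∀ μ, μ ≠ ν₀ → q μ = 0) :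
    ∃ i, (isHermitian_covLapF K c m2 (kingConstLink K (pauliLink (d := d) a b ν₀ ν₁))).eigenvalues i
      ≤ m2 + 2 * c * (1 - Real.cos b) + 2 * c * (1 - Real.cos (sOf K q ν₀ - a)) := by
  obtain ⟨i, hi⟩ := exists_eigenvalue_le_fibre K (pauliLink (d := d) a b ν₀ ν₁) c m2 q xiX_ne_zero
  refine ⟨i, hi.trans_eq ?_⟩
  rw [re_form_fibreOp_eq K (pauliLink_mem_unitaryGroup a b ν₀ ν₁) c m2 q xiX, sum_bond_sq_xiX K a b hν q hq, sum_norm_sq_xiX]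
  field_simp
  ring

/-- ★ … in particular `≤ m² + 2c(1 − cos b) + c·(q′_{ν₀} − a)²`. [cite: HornJohnson2013, Thm 4.2.2; King1986, (4.4) p.670] -/
theorem exists_eigenvalue_covLapF_pauliLink_le_sq {c : ℝ} (hc : 0 ≤ c) (m2 a b : ℝ) {ν₀ ν₁ : Fin (d + 1)} (hν : ν₀ ≠ ν₁) (q : Tor K) (hq : ∀ μ, μ ≠ ν₀ → q μ = 0) :
    ∃ i, (isHermitian_covLapF K c m2 (kingConstLink K (pauliLink (d := d) a b ν₀ ν₁))).eigenvalues i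
      ≤ m2 + 2 * c * (1 - Real.cos b) + c * (sOf K q ν₀ - a) ^ 2 := by
  obtain ⟨i, hi⟩ := exists_eigenvalue_covLapF_pauliLink_le K c m2 a b hν q hq
  refine ⟨i, hi.trans ?_⟩
  have h := Real.one_sub_sq_div_two_le_cos (x := sOf K q ν₀ - a)
  nlinarith [mul_le_mul_of_nonneg_left (show 2 * (1 - Real.cos (sOf K q ν₀ - a)) ≤ (sOf K q ν₀ - a) ^ 2 by linarith) hc]

end Rayleigh

end Summit.QuantumFields.YangMills.BalabanUVNodes.N15KingModelRung.ConstantCurvature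

end
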